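import Summits.QuantumFields.BalabanUV.Beta.EriceRemainderEnclosureHistoryAutonomyComparisonDualContraction

/-!
# EriceRemainderEnclosureHistoryAutonomyComparisonDualContractionClosed — (E138e) **THE CLOSED THRESHOLD: COMPARISON FOR EVERY ISOTONE EXCESS OVER EVERY ISOTONE
# MEMORY WITH LEVEL-LIPSCHITZ AGE MOMENT `Σ_k k·Λ_k ≤ 1`.**  (E138b) `…ComparisonDualContraction.le_of_isotone_excess_moment` with the STRICT moment condition
# replaced by the closed one (`le_of_isotone_excess_moment_le_one`).  With (E56a) (`L·M̃ > 1` fails for the one-age level hinge) the comparison class of isotone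
# memories with a given level profile is now EXACTLY cut out by the age moment: `θ ≤ 1` compares, and for the hinge profile `θ > 1` fails.

THE IDEA.  INTERPOLATE: `B_s := s·B + (1−s)·b`, `0 ≤ s < 1`, has floor `b`, modulus `s·M`, profile `s·Λ` (moment `s·θ < 1`), lies below `B ≤ B′`, and BOTH excesses
`B′ − B_s = (B′ − B) + (1−s)(B − b)` and `B − B_s = (1−s)(B − b)` are ISOTONE (because `B` is).  (E138b) for the pair `(B_s, B′)`: `h′ ≤ h^s` (the box solution of
`B_s`).  (E138b)'s quantitative form for the pair `(B_s, B)`: the dual steps of `h` over `B_s` are sandwiched `0 ≤ X_n ≤ (1−s)(B − b)(tail) ≤ (1−s)β̄`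
(`dual_steps_sandwich`), so by (E138a) `gap_le_sum_parts` the level of `h` at scale `j` exceeds that of `h^s` by at most `j·(1−s)·β̄`.  Hence
`1∕h′_j² ≥ 1∕(h^s_j)² ≥ 1∕h_j² − j(1−s)β̄` for every `s < 1`: let `s → 1`.  No continuity of the solution in the functional is needed.

Cell `pub-balaban`, β-function sub-cell, BINDER row D4 «RemainderConst leaves for Bałaban's split» (`HOME/BINDER-OWNERS.md`; owner lineage `b2b-balaban-beta-an4`;
this file by co-owner #2 lineage `b2b-balaban-beta-d4-p2`, generation 106), β-FLOW TEAM duty (1), FREEZE (0) honoured (def-free: the interpolated functional is a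
displayed lambda term; (E138b) `le_of_isotone_excess_moment` ∕ `dual_steps_sandwich`, (E138a) `gap_le_sum_parts`, (E39) `exists_memFlow_zm`, (E43b)
`memFlow_unique_of_monotone_zm` BY NAME; nothing restated).

HONEST FRAMING (page 1, verbatim and binding).  *"Discharging BetaPertH makes Bałaban's UV stability UNCONDITIONAL — a real constructive-QFT result; it is
NOT the continuum limit and NOT the Clay problem."*  THIS FILE DISCHARGES NOTHING OF THE KIND.  Elementary real analysis about ABSTRACT functionals on a box
]0,γ]^ℕ — hypotheses of a census, not facts; nothing about Bałaban's (1.22) limit functional is PRINTED in this form ([I] p. 298; GAPS G-t4-U2-1∕-2) or asserted.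
Row D4 class UNCHANGED (critical-path width 0; instance 0∕1; D4 DISCHARGE NO DATE).  NOT B12 Thm 2, NOT BetaPertH, NOT continuum YM, NOT Clay.

WHAT IS PROVED ([folklore]; 0 `def`, 0 sorry).  §1 `interp_floor`, `interp_le`, `interp_mono`, `interp_zm`, `interp_profile`.  §2 **`le_of_isotone_excess_moment_le_one`**.
-/

noncomputable section
open Finset Set

namespace Summit.QuantumFields.BalabanUV.Beta.EriceRemainderEnclosureHistoryAutonomyComparisonDualContractionClosed

open Literature.MathematicalPhysics.QuantumFieldTheory.Balaban1983to89
open Literature.MathematicalPhysics.QuantumFieldTheory.Balaban1983to89.T4BetaStationary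
open Literature.MathematicalPhysics.QuantumFieldTheory.Balaban1983to89.T4BetaFlowWellPosed
open Summit.QuantumFields.BalabanUV.Beta.EriceRemainderEnclosureHistoryAutonomyComparisonDualContractionLinks (gap_le_sum_parts)
open Summit.QuantumFields.BalabanUV.Beta.EriceRemainderEnclosureHistoryAutonomyComparisonDualContraction
  (dual_steps_sandwich le_of_isotone_excess_moment)

variable {B B' : (ℕ → ℝ) → ℝ} {M γ b : ℝ} {h h' : ℕ → ℝ}

/-! ## §1 The interpolated memory `B_s = s·B + (1−s)·b` -/

/-- THE INTERPOLATED MEMORY keeps the floor: `b ≤ s·B u + (1−s)·b` for `s ≥ 0` when `b ≤ B u`. [folklore] -/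
theorem interp_floor {s : ℝ} (hs0 : 0 ≤ s) (hlo : ∀ u, SeqBox γ u → b ≤ B u) (u : ℕ → ℝ) (hu : SeqBox γ u) :
    b ≤ (fun w : ℕ → ℝ => s * B w + (1 - s) * b) u := by
  simp only
  nlinarith [mul_nonneg hs0 (sub_nonneg.mpr (hlo u hu))]

/-- … lies below `B` (`s ≤ 1`, `b ≤ B`). [folklore] -/
theorem interp_le {s : ℝ} (hs1 : s ≤ 1) (hlo : ∀ u, SeqBox γ u → b ≤ B u) (u : ℕ → ℝ) (hu : SeqBox γ u) :
    (fun w : ℕ → ℝ => s * B w + (1 - s) * b) u ≤ B u := by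
  simp only
  nlinarith [mul_nonneg (sub_nonneg.mpr hs1) (sub_nonneg.mpr (hlo u hu))]

/-- … is isotone (`s ≥ 0`). [folklore] -/
theorem interp_mono {s : ℝ} (hs0 : 0 ≤ s) (hmono : ∀ u v : ℕ → ℝ, SeqBox γ u → SeqBox γ v → (∀ i, u i ≤ v i) → B u ≤ B v) :
    ∀ u v : ℕ → ℝ, SeqBox γ u → SeqBox γ v → (∀ i, u i ≤ v i) →
      (fun w : ℕ → ℝ => s * B w + (1 - s) * b) u ≤ (fun w : ℕ → ℝ => s * B w + (1 - s) * b) v := by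
  intro u v hu hv huv
  simp only
  nlinarith [hmono u v hu hv huv]

/-- … has zeroth moment `s·M`. [folklore] -/
theorem interp_zm {s : ℝ} (hs0 : 0 ≤ s)
    (hB : ∀ u u' : ℕ → ℝ, SeqBox γ u → SeqBox γ u' → ∀ D : ℝ, (∀ j, |u j - u' j| ≤ D) → |B u - B u'| ≤ M * D) :
    ∀ u u' : ℕ → ℝ, SeqBox γ u → SeqBox γ u' → ∀ D : ℝ, (∀ j, |u j - u' j| ≤ D) →
      |(fun w : ℕ → ℝ => s * B w + (1 - s) * b) u - (fun w : ℕ → ℝ => s * B w + (1 - s) * b) u'| ≤ s * M * D := by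
  intro u u' hu hu' D hD
  simp only
  rw [show s * B u + (1 - s) * b - (s * B u' + (1 - s) * b) = s * (B u - B u') by ring, abs_mul, abs_of_nonneg hs0, mul_assoc]
  exact mul_le_mul_of_nonneg_left (hB u u' hu hu' D hD) hs0

/-- … and has the SCALED level profile `s·Λ` wherever `B` has the profile `Λ`. [folklore] -/
theorem interp_profile {s : ℝ} {Λ : ℕ → ℝ} {K : ℕ} (hs0 : 0 ≤ s)
    (hLip : ∀ u v : ℕ → ℝ, SeqBox γ u → SeqBox γ v → (∀ k : ℕ, 1 / γ ^ 2 + ((k : ℝ) + 1) * b ≤ 1 / u k ^ 2) →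
      (∀ k : ℕ, 1 / γ ^ 2 + ((k : ℝ) + 1) * b ≤ 1 / v k ^ 2) → B u - B v ≤ ∑ k ∈ range K, Λ k * max (1 / v k ^ 2 - 1 / u k ^ 2) 0) :
    ∀ u v : ℕ → ℝ, SeqBox γ u → SeqBox γ v → (∀ k : ℕ, 1 / γ ^ 2 + ((k : ℝ) + 1) * b ≤ 1 / u k ^ 2) →
      (∀ k : ℕ, 1 / γ ^ 2 + ((k : ℝ) + 1) * b ≤ 1 / v k ^ 2) →
      (fun w : ℕ → ℝ => s * B w + (1 - s) * b) u - (fun w : ℕ → ℝ => s * B w + (1 - s) * b) v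
        ≤ ∑ k ∈ range K, (s * Λ k) * max (1 / v k ^ 2 - 1 / u k ^ 2) 0 := by
  intro u v hu hv hgu hgv
  simp only
  have h1 := mul_le_mul_of_nonneg_left (hLip u v hu hv hgu hgv) hs0
  rw [mul_sum] at h1
  have e : ∑ k ∈ range K, s * (Λ k * max (1 / v k ^ 2 - 1 / u k ^ 2) 0) = ∑ k ∈ range K, (s * Λ k) * max (1 / v k ^ 2 - 1 / u k ^ 2) 0 :=
    sum_congr rfl fun k _ => by ring
  linarith [h1, e.symm.le, e.le]

/-! ## §2 The closed threshold -/

/-- **COMPARISON ON THE CLOSED THRESHOLD `Σ_k k·Λ_k ≤ 1`.**  Same data as (E138b) `le_of_isotone_excess_moment` — `B` isotone with zeroth moment `M`, floor `b > 0`,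
level-Lipschitz age profile `Λ ≥ 0` on the graded box, `B ≤ B′ ≤ β̄` on the box, ISOTONE excess, any box solutions `h`, `h′` of `B`, `B′` from one pin — but with the
age moment allowed to REACH one.  Then still `h′ ≤ h` at every scale.  Proof: the interpolated memory `B_s = s·B + (1−s)·b` (`0 ≤ s < 1`) has profile `s·Λ`, moment
`< 1`, floor `b`, and lies below `B ≤ B′` with BOTH excesses `B′ − B_s`, `B − B_s = (1−s)(B − b)` isotone; (E138b) compares `h′` with `B_s`'s solution `h^s`
(`h′ ≤ h^s`), and its quantitative form (`dual_steps_sandwich`: dual steps of `h` over `B_s` at most the source `(1−s)(B − b) ≤ (1−s)β̄`; (E138a) `gap_le_sum_parts`)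
puts `h` within level distance `j·(1−s)·β̄` of `h^s` at scale `j`; let `s → 1`.  No continuity of the solution in the functional is used. [folklore] -/
theorem le_of_isotone_excess_moment_le_one {Λ : ℕ → ℝ} {K : ℕ} {βb p : ℝ}
    (hmono : ∀ u v : ℕ → ℝ, SeqBox γ u → SeqBox γ v → (∀ i, u i ≤ v i) → B u ≤ B v)
    (hB : ∀ u u' : ℕ → ℝ, SeqBox γ u → SeqBox γ u' → ∀ D : ℝ, (∀ j, |u j - u' j| ≤ D) → |B u - B u'| ≤ M * D) (hM : 0 ≤ M)
    (hb : 0 < b) (hlo : ∀ u, SeqBox γ u → b ≤ B u)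
    (hΛ : ∀ k, 0 ≤ Λ k) (hθ : ∑ k ∈ range K, (k : ℝ) * Λ k ≤ 1)
    (hLip : ∀ u v : ℕ → ℝ, SeqBox γ u → SeqBox γ v → (∀ k : ℕ, 1 / γ ^ 2 + ((k : ℝ) + 1) * b ≤ 1 / u k ^ 2) →
      (∀ k : ℕ, 1 / γ ^ 2 + ((k : ℝ) + 1) * b ≤ 1 / v k ^ 2) → B u - B v ≤ ∑ k ∈ range K, Λ k * max (1 / v k ^ 2 - 1 / u k ^ 2) 0)
    (hexc : ∀ u, SeqBox γ u → B u ≤ B' u) (hbdd : ∀ u, SeqBox γ u → B' u ≤ βb)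
    (hDmono : ∀ u v : ℕ → ℝ, SeqBox γ u → SeqBox γ v → (∀ i, u i ≤ v i) → B' u - B u ≤ B' v - B v)
    (hp : 0 < p) (hpγ : p ≤ γ) (hh : SeqBox γ h) (hf : MemFlow B p h) (hh' : SeqBox γ h') (hf' : MemFlow B' p h') (j : ℕ) :
    h' j ≤ h j := by
  -- scale 0 is the common pin
  rcases Nat.eq_zero_or_pos j with hj0 | hjpos
  · subst hj0; rw [hf.1, hf'.1]
  have hpj : 0 < h j := (hh j).1
  have hpj' : 0 < h' j := (hh' j).1
  -- β̄ ≥ b > 0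
  have hβb : 0 < βb := by
    have hcst : SeqBox γ (fun _ => p) := fun _ => ⟨hp, hpγ⟩
    linarith [hlo _ hcst, hexc _ hcst, hbdd _ hcst]
  -- it suffices to prove the level inequality up to every δ > 0
  suffices key : ∀ δ : ℝ, 0 < δ → 1 / h j ^ 2 - δ ≤ 1 / h' j ^ 2 by
    have hlev : 1 / h j ^ 2 ≤ 1 / h' j ^ 2 := by
      by_contra hlt
      have hlt' : 1 / h' j ^ 2 < 1 / h j ^ 2 := lt_of_not_ge hlt
      have := key ((1 / h j ^ 2 - 1 / h' j ^ 2) / 2) (by linarith)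
      linarith
    have hsq : h' j ^ 2 ≤ h j ^ 2 := (one_div_le_one_div (pow_pos hpj 2) (pow_pos hpj' 2)).mp hlev
    exact (pow_le_pow_iff_left₀ hpj'.le hpj.le two_ne_zero).mp hsq
  intro δ hδ
  -- the interpolation parameter: t = 1 − s ∈ ]0,1] with t·j·β̄ ≤ δ
  set t : ℝ := min 1 (δ / ((j : ℝ) * βb + 1)) with ht
  have hjβ : 0 < (j : ℝ) * βb + 1 := by positivity
  have ht0 : 0 < t := lt_min one_pos (div_pos hδ hjβ)
  have ht1 : t ≤ 1 := min_le_left _ _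
  have htδ : t * ((j : ℝ) * βb) ≤ δ := by
    have h1 : t ≤ δ / ((j : ℝ) * βb + 1) := min_le_right _ _
    have h2 : t * ((j : ℝ) * βb + 1) ≤ δ := (le_div_iff₀ hjβ).mp h1
    nlinarith [ht0.le, hβb.le]
  set s : ℝ := 1 - t with hs
  have hs0 : 0 ≤ s := by linarith
  have hs1 : s ≤ 1 := by linarith
  have hslt : s < 1 := by linarith
  -- the interpolated memory and its structural data
  set Bs : (ℕ → ℝ) → ℝ := fun w => s * B w + (1 - s) * b with hBs
  have hmono_s := interp_mono (B := B) (γ := γ) (b := b) hs0 hmono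
  have hB_s := interp_zm (B := B) (γ := γ) (b := b) (M := M) hs0 hB
  have hM_s : 0 ≤ s * M := mul_nonneg hs0 hM
  have hlo_s : ∀ u, SeqBox γ u → b ≤ Bs u := fun u hu => interp_floor hs0 hlo u hu
  have hle_s : ∀ u, SeqBox γ u → Bs u ≤ B u := fun u hu => interp_le hs1 hlo u hu
  have hLip_s := interp_profile (B := B) (γ := γ) (b := b) (Λ := Λ) (K := K) hs0 hLip
  have hΛ_s : ∀ k, 0 ≤ s * Λ k := fun k => mul_nonneg hs0 (hΛ k)
  have hθ_s : ∑ k ∈ range K, (k : ℝ) * (s * Λ k) < 1 := by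
    have e : ∑ k ∈ range K, (k : ℝ) * (s * Λ k) = s * ∑ k ∈ range K, (k : ℝ) * Λ k := by
      rw [mul_sum]; exact sum_congr rfl fun k _ => by ring
    rw [e]
    have h0 : 0 ≤ ∑ k ∈ range K, (k : ℝ) * Λ k := sum_nonneg fun k _ => mul_nonneg (Nat.cast_nonneg k) (hΛ k)
    nlinarith
  -- the unique base family of B_s
  have hex : ∀ q : ℝ, 0 < q → q ≤ γ → ∃ k : ℕ → ℝ, SeqBox γ k ∧ MemFlow Bs q k :=
    fun q hq hqγ => Summit.QuantumFields.BalabanUV.Beta.EriceRemainderEnclosureHistoryAutonomyExistence.exists_memFlow_zm hB_s hM_s hq hqγ hb hlo_s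
  choose! S hSb hSf using hex
  have hS : ∀ q, 0 < q → q ≤ γ → SeqBox γ (S q) ∧ MemFlow Bs q (S q) := fun q hq hqγ => ⟨hSb q hq hqγ, hSf q hq hqγ⟩
  have huniq : ∀ q, 0 < q → q ≤ γ → ∀ u u' : ℕ → ℝ, SeqBox γ u → SeqBox γ u' → MemFlow Bs q u → MemFlow Bs q u' → u = u' :=
    fun q hq _ u u' hu hu' hfu hfu' =>
      Summit.QuantumFields.BalabanUV.Beta.EriceRemainderEnclosureHistoryAutonomyMonotoneGeneral.memFlow_unique_of_monotone_zm hmono_s hB_s hM_s hq hb hlo_s hu hu' hfu hfu'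
  -- (1) h′ ≤ h^s := S p, by (E138b) for the pair (B_s, B′)
  have hexc_s : ∀ u, SeqBox γ u → Bs u ≤ B' u := fun u hu => (hle_s u hu).trans (hexc u hu)
  have hDmono_s : ∀ u v : ℕ → ℝ, SeqBox γ u → SeqBox γ v → (∀ i, u i ≤ v i) → B' u - Bs u ≤ B' v - Bs v := by
    intro u v hu hv huv
    have h1 := hDmono u v hu hv huv
    have h2 := hmono u v hu hv huv
    simp only [hBs]
    nlinarith
  have hcmp1 : h' j ≤ S p j :=
    le_of_isotone_excess_moment hmono_s hB_s hM_s hb hlo_s hΛ_s hθ_s hLip_s hexc_s hbdd hDmono_s hp hpγ (hS p hp hpγ).1 (hS p hp hpγ).2 hh' hf' j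
  -- (2) h is level-close to h^s: the dual steps of h over B_s are at most (1−s)(B − b) ≤ t·β̄
  have hbddB : ∀ u, SeqBox γ u → B u ≤ βb := fun u hu => (hexc u hu).trans (hbdd u hu)
  have hDmonoB : ∀ u v : ℕ → ℝ, SeqBox γ u → SeqBox γ v → (∀ i, u i ≤ v i) → B u - Bs u ≤ B v - Bs v := by
    intro u v hu hv huv
    have h2 := hmono u v hu hv huv
    simp only [hBs]
    nlinarith
  have hX : ∀ n, max (1 / h (0 + n + 1) ^ 2 - 1 / S (h (0 + n)) 1 ^ 2) 0 ≤ t * βb := by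
    intro n
    rw [Nat.zero_add]
    have hsw := dual_steps_sandwich (B := Bs) (B' := B) hb hmono_s hB_s hM_s hlo_s hS huniq hΛ_s hθ_s hLip_s hle_s hbddB hDmonoB hh hp hpγ hf n
    have htail : SeqBox γ (fun i => h (n + 1 + i)) := fun i => hh (n + 1 + i)
    have hsrc : B (fun i => h (n + 1 + i)) - Bs (fun i => h (n + 1 + i)) ≤ t * βb := by
      simp only [hBs]
      have h1 := hbddB _ htail
      have h2 := hlo _ htail
      nlinarith [ht0.le]
    exact max_le (hsw.2.trans hsrc) (by positivity)
  obtain ⟨k, rfl⟩ : ∃ k, j = k + 1 := ⟨j - 1, by omega⟩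
  have hgap := (gap_le_sum_parts (B := Bs) (h' := h) hb hmono_s hB_s hM_s hlo_s hS huniq hh k 0).1
  have hsum : ∑ l ∈ range (k + 1), max (1 / h (0 + l + 1) ^ 2 - 1 / S (h (0 + l)) 1 ^ 2) 0 ≤ ∑ l ∈ range (k + 1), t * βb :=
    sum_le_sum fun l _ => hX l
  rw [sum_const, card_range, nsmul_eq_mul] at hsum
  have e0 : S (h 0) = S p := by rw [hf.1]
  rw [e0, show 0 + 1 + k = k + 1 by omega] at hgap
  -- hgap : 1/h(k+1)² − 1/(S p)(k+1)² ≤ Σ ≤ (k+1)·t·β̄ ≤ δ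
  have hclose : 1 / h (k + 1) ^ 2 - 1 / S p (k + 1) ^ 2 ≤ δ := by
    have : ((k + 1 : ℕ) : ℝ) * (t * βb) ≤ δ := by push_cast at htδ ⊢; nlinarith [htδ]
    linarith [hgap, hsum]
  -- (3) combine with h′ ≤ S p at scale k+1
  have hposS : 0 < S p (k + 1) := ((hS p hp hpγ).1 (k + 1)).1
  have hlev1 : 1 / S p (k + 1) ^ 2 ≤ 1 / h' (k + 1) ^ 2 :=
    one_div_le_one_div_of_le (pow_pos hpj' 2) (pow_le_pow_left₀ hpj'.le hcmp1 2)
  linarith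

end Summit.QuantumFields.BalabanUV.Beta.EriceRemainderEnclosureHistoryAutonomyComparisonDualContractionClosed

end
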